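import Summits.ResolutionOfSingularities.ResolutionOfSingularities.Theorems.HomologicalConductorNoZenoSeam1Package
import HarnessLib

/-!
# Crux `NoZenoR` (stmt-ResolutionOfSingularities-19943) — slot 5 (B1) closer: THE SEAM-1 PACKAGE, GENERIC ENTRY (Route M, upstairs use)

Route `ResolutionOfSingularities/HomologicalConductor`, W4.4 chain, slot 5 `stub_L1wCoreF3`.  `exists_seam1Package_of_resolution`: the
∃-package of res-L0-w44-stub-3's `exists_seam1Package` (p573278) with the chart data `(π, ρ, IsResolution (ρ ≫ π), hprin)` as INPUTS instead
of the literal habitat hypothesis `IsSepX1Sandwiched` — needed because the closer runs seam-1/seam-2 UPSTAIRS over the splitting germ, where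
the blow-up is the pull-back of the downstairs node blow-up (centre `σ⁻¹(sepNodes π)`, seam0) and not the literal sep-node blow-up.
Def-free; facts `Lipman1969_1_2`, `Lipman1969_12_1_i` as binders; `--supports 19943 --as helper`.  OURS (cell res-hironaka, lead
res-L0-w44-lead-1 g9 adapting stub-3's file): AI-produced and kernel-checked, weaker than expert review; nothing here is a statement of
the manuscript under review (Hironaka 2017); counted 0.
-/

noncomputable section

-- single-problem summit: the doubled namespace component `ResolutionOfSingularities` is forced
set_option linter.dupNamespace false

open CategoryTheory CategoryTheory.Limits AlgebraicGeometry TopologicalSpace Opposite IsLocalRing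
open Literature.AlgebraicGeometry Literature.AlgebraicGeometry.Resolution Literature.AlgebraicGeometry.Motives
open Summit.ResolutionOfSingularities.ResolutionOfSingularities.Theorems.NoZeno.Birth
open Summit.ResolutionOfSingularities.ResolutionOfSingularities.Theorems.NoZeno.SandwichCluster
open Summit.ResolutionOfSingularities.ResolutionOfSingularities.Theorems.NoZeno.SandwichCluster.Parasite
  (locPrime isLocalRing_locPrime mem_locPrime_of_mem)
open Summit.ResolutionOfSingularities.ResolutionOfSingularities.Theorems.NoZeno.SandwichCluster.Thread
  (toSubring_le_locPrime isLocalization_locPrime essFiniteType_blowupChart)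
open Summit.ResolutionOfSingularities.ResolutionOfSingularities.Theorems.NoZeno.SplittingBase
  (locPrimeSubalgebra le_locPrimeSubalgebra)
open Summit.ResolutionOfSingularities.ResolutionOfSingularities.Theorems.SyzygyFlattening
  (self_le_nrm isIntegrallyClosed_nrm stub_essFiniteType_nrm)
open Summit.ResolutionOfSingularities.ResolutionOfSingularities.Theorems.SurfaceTermination

namespace Summit.ResolutionOfSingularities.ResolutionOfSingularities.Theorems.NoZeno.ExcCount

variable {k K : Type} [Field k] [Field K] [Algebra k K]

/-- **THE SEAM-1 PACKAGE, GENERIC ENTRY (ROUTE M).**  Same outputs as `exists_seam1Package` (minus the minimality of `π` and the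
identification of the centre of `ρ`, which the caller holds when true), but the chart data are INPUTS: ANY resolution `ρ ≫ π` of the
germ `D = T_P` through a morphism `ρ : X¹ → X` over `π : X → Spec D`, with `I·𝒪_{X¹}` principal at every point over the closed
point.  This is the form the closer applies UPSTAIRS, where the sandwich datum is the pulled-back blow-up of a finite centre
(res-L0-w44-lead-1 SHAPE OBJECTION 21:28:09Z).  Proof = the proof of `exists_seam1Package` with (1β) replaced by
`ChartResolution.exists_functionField_ringEquiv` + `exists_lift_affineBlowup`.
[cite: Lipman1969, Theorem (12.1) (i) (p. 220); Lipman1969, Section 10 (p. 212); StacksProject, Tag 03H0] -/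
theorem exists_seam1Package_of_resolution (h12 : Lipman1969_1_2.{0}) (h121 : Lipman1969_12_1_i.{0})
    (T : Subalgebra k K) (P : Ideal ↥T) (hP : P.IsPrime)
    [Algebra.EssFiniteType k ↥T] [IsIntegrallyClosed ↥T] [IsFractionRing ↥T K]
    (hdim : ringKrullDim ↥(locPrime T P hP) = 2) (hrat : HasRationalSingularity ↥(locPrime T P hP))
    (C : Set K) (hCT : C ⊆ (T : Set K))
    (hrad : (Ideal.span {d : ↥(locPrime T P hP) | (d : K) ∈ C}).radical =
      @maximalIdeal ↥(locPrime T P hP) _ (isLocalRing_locPrime T P hP))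
    (x : K) (hxC : x ∈ C) (hx0 : x ≠ 0)
    (B : Subalgebra k K) (hB : B = Algebra.adjoin k ((locPrime T P hP : Set K) ∪ {y : K | ∃ c ∈ C, y = c * x⁻¹}))
    (𝔮 : Ideal ↥(nrm B)) (h𝔮 : 𝔮.IsPrime) (D' : Subring K) (hD' : IsLocalRing ↥D')
    (hEq : locPrime (nrm B) 𝔮 h𝔮 = D') (hDD' : (locPrime T P hP : Set K) ⊆ D')
    (hdim' : ringKrullDim ↥D' = 2) (hnorm' : IsIntegrallyClosed ↥D')
    -- the chart data (generic: ANY resolution `ρ ≫ π` factoring through a blow-up `ρ`, with `I·𝒪` principal over the closed point)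
    {X : Scheme.{0}} (π : X ⟶ Spec (.of ↥(locPrime T P hP))) {X1 : Scheme.{0}} [IsIntegral X1] (ρ : X1 ⟶ X)
    (hψ1 : IsResolution (ρ ≫ π))
    (hprin : ∀ x₁ : X1, IsLocalHom (toStalk (ρ ≫ π) x₁) →
      ((Ideal.span {d : ↥(locPrime T P hP) | (d : K) ∈ C}).map (toStalk (ρ ≫ π) x₁)).IsPrincipal) :
    ∃ (_ : IsLocallyNoetherian X1)
      (C𝔮 : Set X1) (W : Scheme.{0}) (_ : IsIntegral W) (ψ : W ⟶ Spec (.of ↥D')) (_ : IsResolution ψ)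
      (gW : W ⟶ X1),
      C𝔮 ⊆ excCurvePoints (ρ ≫ π) ∧
      (¬ IsRegularLocalRing ↥D' →
        ∀ a ∈ C𝔮, ∀ b ∈ C𝔮, ∃ p : (incidenceGraph (ρ ≫ π)).Walk a b, ∀ v ∈ p.support, v ∈ C𝔮) ∧
      (∃ η₀ ∈ excCurvePoints (ρ ≫ π), η₀ ∉ C𝔮) ∧
      (∀ y ∈ excCurvePoints ψ, gW.base y ∈ C𝔮) ∧ Set.InjOn gW.base (excCurvePoints ψ) ∧
      (∀ w : W, IsIso (gW.stalkMap w)) ∧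
      (∀ η ∈ C𝔮, closure ({η} : Set X1) ⊆ Set.range gW.base) ∧
      ∃ f : ↥(locPrime T P hP) →+* ↥D', (∀ d, ((f d : ↥D') : K) = (d : K)) ∧
        gW ≫ ρ ≫ π = ψ ≫ Spec.map (CommRingCat.ofHom f) := by
  -- (S2) the germ as a `k`-subalgebra `T'` (same carrier as `locPrime T P hP`), its instances, `I`, `x'`
  haveI : IsNoetherianRing ↥T := Algebra.EssFiniteType.isNoetherianRing k ↥T
  haveI : IsLocalRing ↥(locPrimeSubalgebra T P hP) := isLocalRing_locPrime T P hP
  have hxT : x ∈ locPrimeSubalgebra T P hP := le_locPrimeSubalgebra T P hP (hCT hxC)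
  have hxI : (⟨x, hxT⟩ : ↥(locPrimeSubalgebra T P hP)) ∈
      Ideal.span {d : ↥(locPrimeSubalgebra T P hP) | (d : K) ∈ C} :=
    Ideal.subset_span (show ((⟨x, hxT⟩ : ↥(locPrimeSubalgebra T P hP)) : K) ∈ C from hxC)
  have hx0' : ((⟨x, hxT⟩ : ↥(locPrimeSubalgebra T P hP)) : K) ≠ 0 := hx0
  have hdimT : ringKrullDim ↥(locPrimeSubalgebra T P hP) = 2 := hdim
  have hradT : (Ideal.span {d : ↥(locPrimeSubalgebra T P hP) | (d : K) ∈ C}).radical =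
      maximalIdeal ↥(locPrimeSubalgebra T P hP) := hrad
  have hratT : HasRationalSingularity ↥(locPrimeSubalgebra T P hP) := hrat
  -- (S1) the chart ring in the ideal spelling; `B` and `D'` become literal
  have hBB : B = Algebra.adjoin k (((locPrimeSubalgebra T P hP : Subalgebra k K) : Set K) ∪
      {y : K | ∃ c : ↥(locPrimeSubalgebra T P hP),
        c ∈ Ideal.span {d : ↥(locPrimeSubalgebra T P hP) | (d : K) ∈ C} ∧
          y = (c : K) * ((⟨x, hxT⟩ : ↥(locPrimeSubalgebra T P hP)) : K)⁻¹}) :=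
    hB.trans (adjoin_locPrime_chart_set_eq T P hP hCT hxC)
  subst hBB
  subst hEq
  -- (1β′) the chart data, GENERIC: `ψ₁ := ρ ≫ π` read over `T'`, its function field, its lift to `Bl_I`
  change X ⟶ Spec (.of ↥(locPrimeSubalgebra T P hP)) at π
  change IsResolution (ρ ≫ π) at hψ1
  change ∀ x₁ : X1, IsLocalHom (toStalk (ρ ≫ π) x₁) →
      ((Ideal.span {d : ↥(locPrimeSubalgebra T P hP) | (d : K) ∈ C}).map (toStalk (ρ ≫ π) x₁)).IsPrincipal at hprin
  haveI : IsProper (ρ ≫ π) := hψ1.isProper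
  haveI : IsDominant (ρ ≫ π) := hψ1.isBirational.isDominant
  haveI : IsLocallyNoetherian X1 := LocallyOfFiniteType.isLocallyNoetherian (ρ ≫ π)
  obtain ⟨e, he⟩ := ChartResolution.exists_functionField_ringEquiv (locPrimeSubalgebra T P hP) (ρ ≫ π) hψ1.isBirational
  have hI0 : Ideal.span {d : ↥(locPrimeSubalgebra T P hP) | (d : K) ∈ C} ≠ ⊥ := fun h => by
    apply hx0'
    have : (⟨x, hxT⟩ : ↥(locPrimeSubalgebra T P hP)) = 0 := by simpa [h] using hxI
    rw [this]; rfl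
  obtain ⟨c, hc⟩ := exists_maximalIdeal_pow_le_of_radical_eq hradT
  obtain ⟨σB, hσB⟩ := exists_lift_affineBlowup (ρ ≫ π) _ hI0 hc hprin
  -- `P ≠ ∅`
  have hIm : Ideal.span {d : ↥(locPrimeSubalgebra T P hP) | (d : K) ∈ C} ≤ maximalIdeal _ :=
    hradT ▸ Ideal.le_radical
  obtain ⟨hJ, η₀, hη₀, hneg⟩ := exists_excCurveDegree_baseIdealDivisor_neg_of_hasRationalSingularity
    (locPrimeSubalgebra T P hP) (ρ ≫ π) h12 h121 hdimT hratT hψ1 hI0 hc hIm hprin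
  -- the normalised chart ring is Noetherian (essentially of finite type over `k`)
  have hDB : locPrimeSubalgebra T P hP ≤ Algebra.adjoin k (((locPrimeSubalgebra T P hP : Subalgebra k K) : Set K) ∪
      {y : K | ∃ c : ↥(locPrimeSubalgebra T P hP),
        c ∈ Ideal.span {d : ↥(locPrimeSubalgebra T P hP) | (d : K) ∈ C} ∧
          y = (c : K) * ((⟨x, hxT⟩ : ↥(locPrimeSubalgebra T P hP)) : K)⁻¹}) :=
    fun y hy => Algebra.subset_adjoin (Or.inl hy)
  haveI : Algebra.EssFiniteType k ↥(Algebra.adjoin k (((locPrimeSubalgebra T P hP : Subalgebra k K) : Set K) ∪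
      {y : K | ∃ c : ↥(locPrimeSubalgebra T P hP),
        c ∈ Ideal.span {d : ↥(locPrimeSubalgebra T P hP) | (d : K) ∈ C} ∧
          y = (c : K) * ((⟨x, hxT⟩ : ↥(locPrimeSubalgebra T P hP)) : K)⁻¹})) :=
    essFiniteType_blowupChart T P hP C hCT x _ hB
  haveI : IsFractionRing ↥(Algebra.adjoin k (((locPrimeSubalgebra T P hP : Subalgebra k K) : Set K) ∪
      {y : K | ∃ c : ↥(locPrimeSubalgebra T P hP),
        c ∈ Ideal.span {d : ↥(locPrimeSubalgebra T P hP) | (d : K) ∈ C} ∧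
          y = (c : K) * ((⟨x, hxT⟩ : ↥(locPrimeSubalgebra T P hP)) : K)⁻¹})) K :=
    isFractionRing_subalgebra_of_le _ _ hDB
  haveI : Algebra.EssFiniteType k ↥(nrm (Algebra.adjoin k (((locPrimeSubalgebra T P hP : Subalgebra k K) : Set K) ∪
      {y : K | ∃ c : ↥(locPrimeSubalgebra T P hP),
        c ∈ Ideal.span {d : ↥(locPrimeSubalgebra T P hP) | (d : K) ∈ C} ∧
          y = (c : K) * ((⟨x, hxT⟩ : ↥(locPrimeSubalgebra T P hP)) : K)⁻¹}))) :=
    stub_essFiniteType_nrm k K _ inferInstance inferInstance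
  haveI : IsNoetherianRing ↥(nrm (Algebra.adjoin k (((locPrimeSubalgebra T P hP : Subalgebra k K) : Set K) ∪
      {y : K | ∃ c : ↥(locPrimeSubalgebra T P hP),
        c ∈ Ideal.span {d : ↥(locPrimeSubalgebra T P hP) | (d : K) ∈ C} ∧
          y = (c : K) * ((⟨x, hxT⟩ : ↥(locPrimeSubalgebra T P hP)) : K)⁻¹}))) :=
    Algebra.EssFiniteType.isNoetherianRing k _
  -- (G4) `𝔮` is maximal over `𝔪`
  obtain ⟨h𝔮max, h𝔪⟩ := ChartFibre.isMaximal_and_comap_eq_chart_ideal (locPrimeSubalgebra T P hP) hdimT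
    (IsNoetherian.noetherian _) ⟨x, hxT⟩ (ChartResolution.le_nrm_adjoin (locPrimeSubalgebra T P hP)) 𝔮 h𝔮 hdim'
  haveI := h𝔮max
  -- the new germ `D' = N_𝔮` as an `N`-algebra, a localisation at `𝔮`
  letI : Algebra ↥(nrm (Algebra.adjoin k (((locPrimeSubalgebra T P hP : Subalgebra k K) : Set K) ∪
      {y : K | ∃ c : ↥(locPrimeSubalgebra T P hP),
        c ∈ Ideal.span {d : ↥(locPrimeSubalgebra T P hP) | (d : K) ∈ C} ∧
          y = (c : K) * ((⟨x, hxT⟩ : ↥(locPrimeSubalgebra T P hP)) : K)⁻¹}))) ↥(locPrime (nrm _) 𝔮 h𝔮) :=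
    (Subring.inclusion (toSubring_le_locPrime (nrm _) 𝔮 h𝔮)).toAlgebra
  haveI := isLocalization_locPrime (nrm (Algebra.adjoin k (((locPrimeSubalgebra T P hP : Subalgebra k K) : Set K) ∪
      {y : K | ∃ c : ↥(locPrimeSubalgebra T P hP),
        c ∈ Ideal.span {d : ↥(locPrimeSubalgebra T P hP) | (d : K) ∈ C} ∧
          y = (c : K) * ((⟨x, hxT⟩ : ↥(locPrimeSubalgebra T P hP)) : K)⁻¹}))) 𝔮 h𝔮
  haveI := hD'
  haveI := hnorm'
  haveI : IsNoetherianRing ↥(locPrime (nrm (Algebra.adjoin k (((locPrimeSubalgebra T P hP : Subalgebra k K) : Set K) ∪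
      {y : K | ∃ c : ↥(locPrimeSubalgebra T P hP),
        c ∈ Ideal.span {d : ↥(locPrimeSubalgebra T P hP) | (d : K) ∈ C} ∧
          y = (c : K) * ((⟨x, hxT⟩ : ↥(locPrimeSubalgebra T P hP)) : K)⁻¹}))) 𝔮 h𝔮) :=
    IsLocalization.isNoetherianRing 𝔮.primeCompl _ inferInstance
  -- (1α) the chart-germ resolution package
  obtain ⟨hne, σ, -, hσc, hσres, hψ', -⟩ := exists_chartGermResolution (locPrimeSubalgebra T P hP) (ρ ≫ π) e he σB hσB
    hxI hψ1 hx0' 𝔮 ↥(locPrime (nrm _) 𝔮 h𝔮)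
  haveI : IsProper σ := hσres.isProper
  haveI : IsPreimmersion (Spec.map (CommRingCat.ofHom (algebraMap ↥(nrm (Algebra.adjoin k
      (((locPrimeSubalgebra T P hP : Subalgebra k K) : Set K) ∪ {y : K | ∃ c : ↥(locPrimeSubalgebra T P hP),
        c ∈ Ideal.span {d : ↥(locPrimeSubalgebra T P hP) | (d : K) ∈ C} ∧
          y = (c : K) * ((⟨x, hxT⟩ : ↥(locPrimeSubalgebra T P hP)) : K)⁻¹}))) ↥(locPrime (nrm _) 𝔮 h𝔮)))) :=
    IsPreimmersion.of_isLocalization 𝔮.primeCompl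
  haveI : Flat (Spec.map (CommRingCat.ofHom (algebraMap ↥(nrm (Algebra.adjoin k
      (((locPrimeSubalgebra T P hP : Subalgebra k K) : Set K) ∪ {y : K | ∃ c : ↥(locPrimeSubalgebra T P hP),
        c ∈ Ideal.span {d : ↥(locPrimeSubalgebra T P hP) | (d : K) ∈ C} ∧
          y = (c : K) * ((⟨x, hxT⟩ : ↥(locPrimeSubalgebra T P hP)) : K)⁻¹}))) ↥(locPrime (nrm _) 𝔮 h𝔮)))) := by
    rw [Flat.SpecMap_iff, CommRingCat.hom_ofHom, RingHom.flat_algebraMap_iff]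
    exact IsLocalization.flat _ 𝔮.primeCompl
  -- the outputs
  refine ⟨inferInstance,
    (σB ⁻¹ᵁ (affineBlowup.chartOpen (⟨x, hxT⟩ : ↥(locPrimeSubalgebra T P hP)) hxI).1).ι.base ''
      {z | σ.base z = ⟨𝔮, inferInstance⟩ ∧ Order.height z = 1},
    pullback σ (Spec.map (CommRingCat.ofHom (algebraMap _ ↥(locPrime (nrm _) 𝔮 h𝔮)))), hψ'.isIntegral_source,
    pullback.snd σ (Spec.map (CommRingCat.ofHom (algebraMap _ ↥(locPrime (nrm _) 𝔮 h𝔮)))), hψ',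
    pullback.fst σ (Spec.map (CommRingCat.ofHom (algebraMap _ ↥(locPrime (nrm _) 𝔮 h𝔮)))) ≫
      (σB ⁻¹ᵁ (affineBlowup.chartOpen (⟨x, hxT⟩ : ↥(locPrimeSubalgebra T P hP)) hxI).1).ι,
    ?_, ?_, ?_, ?_, ?_, ?_, ?_, ?_⟩
  · -- `C𝔮 ⊆ excCurvePoints (ρ ≫ π)`
    exact image_chartFibreCurves_subset_excCurvePoints (locPrimeSubalgebra T P hP) (ρ ≫ π) _ _ σ hσc 𝔮 h𝔪
  · -- walk-connected when `D'` is singular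
    intro hsing
    exact walkConnected_chartFibreCurves (locPrimeSubalgebra T P hP) (ρ ≫ π) _ _ σ hσc 𝔮 h𝔪 _ hdimT hψ1 hdim' hψ'
      hsing
  · -- a curve outside `C𝔮`: the `Z`-negative one
    refine ⟨η₀, hη₀, fun hC => ?_⟩
    exact (disjoint_baseIdealNeg_chartFibreCurves (locPrimeSubalgebra T P hP) (ρ ≫ π) e he σB hσB hxI σ hσc 𝔮 h𝔪
      hx0' hJ).le_bot ⟨⟨hη₀, hneg⟩, hC⟩
  · -- `gW` carries the curves of `ψ` into `C𝔮`
    intro y hy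
    exact ι_fst_mem_chartFibreCurves (T := locPrimeSubalgebra T P hP) (U := _) (σ := σ) (𝔮 := 𝔮) (N' := _) hy
  · -- injectively
    exact (injective_ι_fst (T := locPrimeSubalgebra T P hP) (U := _) (σ := σ) (𝔮 := 𝔮) (N' := _)).injOn
  · -- `gW` is a local isomorphism
    intro w
    exact isIso_stalkMap_of_flat_of_isPreimmersion _ w
  · -- closures of the `C𝔮`-curves lie in `range gW`
    rintro _ ⟨z, ⟨hz, -⟩, rfl⟩ y hy
    obtain ⟨w, hw, rfl⟩ := ChartFibre.exists_eq_ι_of_mem_closure_chart_nrm (locPrimeSubalgebra T P hP) _ (ρ ≫ π)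
      (IsNoetherian.noetherian _) _ σ hσc ⟨𝔮, inferInstance⟩
      (ChartFibre.comap_inclusion_isMaximal_of_eq _ _ 𝔮 h𝔪) z hz hy
    have hwr : w ∈ Set.range (pullback.fst σ
        (Spec.map (CommRingCat.ofHom (algebraMap _ ↥(locPrime (nrm _) 𝔮 h𝔮))))).base := by
      rw [Scheme.Pullback.range_fst]
      exact ⟨closedPoint _, by rw [specMap_localization_closedPoint 𝔮]; exact hw.symm⟩
    obtain ⟨ζ, rfl⟩ := hwr
    exact ⟨ζ, rfl⟩
  · -- the square over `Spec D ← Spec D'`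
    refine ⟨(algebraMap _ ↥(locPrime (nrm _) 𝔮 h𝔮)).comp
      (Subalgebra.inclusion (ChartResolution.le_nrm_adjoin (locPrimeSubalgebra T P hP)
        (I := Ideal.span {d : ↥(locPrimeSubalgebra T P hP) | (d : K) ∈ C}) (x := ⟨x, hxT⟩))).toRingHom,
      fun d => rfl, ?_⟩
    rw [Category.assoc]
    refine (congrArg (fun φ => pullback.fst σ (Spec.map (CommRingCat.ofHom
      (algebraMap _ ↥(locPrime (nrm _) 𝔮 h𝔮)))) ≫ φ) hσc).trans ?_
    dsimp only
    rw [← Category.assoc, pullback.condition, Category.assoc, ← Spec.map_comp, ← CommRingCat.ofHom_comp]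
    rfl

end Summit.ResolutionOfSingularities.ResolutionOfSingularities.Theorems.NoZeno.ExcCount

end
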